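import Summits.QuantumFields.YangMills.Theorems.UnitScaleTiltProp7SectET3Transport
import Literature.MathematicalPhysics.QuantumLattice.SpinGaugeTransformations
import HarnessLib

/-!
# Route `UnitScaleTilt`, crux K1 child «MinimiserStabilityRegPr» (stmt-QuantumFields-19200), skeleton v10, stub `stub_existenceMinimalOrbit` (EX),
# route (α) — **THE CURRENT `J(U₀)` OF (28)∕(111) IS HERMITIAN AND TRACELESS AT EVERY `SU(2)` BACKGROUND** (the concrete third of the knit's reality
# row `hA₁R`: «the solution `A₁` of (111) is `𝔤`-valued»)

Cell `ym3-torus`, width seat `ym-ust-20520-w4` (gen 4).  THEOREMS ONLY (0 `def`, 0 `sorry`).  Plumbing for the reality split (R) of the EX knit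
(knit ruler ★w2-19200 g3, LOCATE (R) 2026-08-28; ★★OWNER ym3-torus-plan g26 ACK 42 «consume by name»): nothing here closes the stub;
`--supports stmt-QuantumFields-19200 --as helper`, count-neutral.  YM₃ on T³ is a ladder rung (R3), not the Clay problem; nothing here claims the stub,
the crux, d = 4 or the mass gap.

THE PRINT.  [Balaban1985Variational] (27)–(28) p. 282: «J = D*η⁻² Im ∂U₀ … from hermiticity of DA»; (51) p. 286: «for A′ with values in 𝔤 the
configuration D(A′) has values in 𝔤 also»; Prop. 6 p. 295: the solution `A₁` of (111) `A₁ + 𝔊J + 𝔊((δ∕δA′)V)(A₁ + H₁B) = 0` is the unique fixed point of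
(116) in the ball (115).  [Balaban1985BackgroundPropagators] (3.11) p. 392: `J = D^{η*}_{U₀}(η⁻² Im ∂U₀)` with `Im U = (2i)⁻¹(U − U*)` on the group.
For `G = SU(2) ⊂ U(2)` the current is `𝔤 = 𝔰𝔲(2)`-valued up to the factor `i`: every `J(b)` is a HERMITIAN TRACELESS `2 × 2` matrix — Hermitian because
`Im` of a unitary is Hermitian and the covariant divergence `D^{η*}_{U₀}` commutes with `*` at a unitary background ([B9] (3.8)), traceless because every
plaquette variable `U₀(∂p)` is an `SU(2)` matrix, whose trace is real, and `D^{η*}` is a signed sum of unitary conjugates (`R(W)X = WXW⁻¹`, trace-preserving)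
and differences.

WHY THIS FILE (the consumer, by name).  The knit's tool ★w2-19200 g3 `Prop7Prop6RealSolution.solution_mem_of_invariant_T3` (⧗p623801) proves: every
solution of (111) in the ball lies in a closed real subspace `S` of (115) provided `𝔊(T) ⊆ S`, **`Jcur (reading of U₀) ∈ T`**, `W(S + 𝔄) ⊆ T`.  With
`T := {f | ∀ b, (f b) Hermitian ∧ tr (f b) = 0}` the middle hypothesis is THIS FILE's `isHermitian_trace_zero_Jcur_T3` ∕ `…_bgOfCfg`; the other two stay
displayed rows about the opaque letters `𝔊(U₀)`, `(δ∕δA′)V` (N06 ∕ P4 class, ym-inputs desk).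

WHAT IS PROVED (sorry-free, no definition).
* §1 (lit-balaban's generic lattice `B9Eq39Adjoint`, any shifts `T`, matrix algebra `M_N(ℂ)`): `trace_R` (`tr R(W)X = tr X`), ★`star_trace_divP`
  (`D^{1*}` preserves «real trace»), ★`star_J_eq_self` (`J(b)* = J(b)` at a unitary background — the `M_N(ℂ)` twin of pub-ymgap's
  `BalabanUVNodesN07SectBExpansionAtObjects.star_J_cfgGL`, here for lit-balaban's abstract `(T, U)`), ★`trace_J_eq_zero` (`tr J(b) = 0` when every
  plaquette variable has real trace).
* §2 (`SU(2)`; `tr W ∈ ℝ` on `SU(2)` is ✓`SpinGauged.star_trace_of_mem_specialUnitaryGroup`, imported): `plaqU_val_mem_su2`, ★★`isHermitian_trace_zero_Jcur` — for ANY reading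
  `U₀ : Bond d Pd → (M₂(ℂ))ˣ` with `SU(2)` values and any weights `(L, η, lev₀)`: `(Jcur U₀)(b)` is Hermitian and traceless.
* §3 (T³): ★★`isHermitian_trace_zero_Jcur_T3` at the chart-generic reading `fun b ↦ unitsField (toUField U₀) ⟨e⁻¹ b.1, b.2⟩` of ✓`Prop7SectET3ObjectsPd` ∕
  ⧗`Prop7Prop6RealSolution` (NO shift-compatibility `he` needed), and ★★`isHermitian_trace_zero_Jcur_bgOfCfg` at the background of record `bgOfCfg F K U₀`
  of ✓`Prop7SectET3Transport` (the letter of the knit's `hXtw″`∕`hA₁R`).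

HONEST SCOPE: finite `*`-algebra; no estimate of the series is used or proved.

References: T. Bałaban, CMP 102 (1985) 277–309 [Balaban1985Variational] ((27)–(28) p.282, (51) p.286, (111) p.294, Prop. 6 p.295); CMP 99 (1985) 389–434
[Balaban1985BackgroundPropagators] ((3.8)–(3.11) p.392).
-/

set_option autoImplicit false

noncomputable section

open Complex
open scoped Matrix.Norms.L2Operator

namespace Summit.QuantumFields.YangMills.Theorems.Prop7SectET3JcurReality

open Literature.MathematicalPhysics.QuantumFieldTheory.Balaban1983to89
open T3ContinuumYM3Torus
open B4Sect5Torus (TSite)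
open B9SectCLatticeCarrier (Bond)
open B10Eq27TorusAxialLog (unitsField toUField val_unitsField suIncl val_suIncl)
open B9Eq39Adjoint (R R_def covDstar divP divPη plaqU J)
open B9Eq310Hermitian (star_eta_sq star_eta_inv plaqU_unitary)
open B11Eq27Current (imPart plaqField J_eq_imPart_div)
open B11Eq115Space (levWeight NegSup NegSize)
open B11Eq98CurrentSlot (Jcur)
open B11Eq90V0primeCurrent (Tsh Ucur)
open Literature.MathematicalPhysics.QuantumLattice.SpinGauged (star_trace_of_mem_specialUnitaryGroup)
open Summit.QuantumFields.YangMills.Theorems.Prop7SectET3Transport (periodsT3 siteEquiv bgOfCfg bgOfCfg_eq)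

/-! ## §1 The generic lattice: `R`, `D^{1*}`, `J` and the trace ∕ the involution on `M_N(ℂ)` -/

section Lattice

variable {N : ℕ} {S : Type*} {ι : Type*} [Fintype ι] [LinearOrder ι]
variable (T : ι → Equiv.Perm S) (U : ι → S → (Matrix (Fin N) (Fin N) ℂ)ˣ)

/-- `tr R(W)X = tr X` — conjugation by a unit preserves the trace. [folklore] [cite: Balaban1985BackgroundPropagators, p.390 («R(U)X = UXU⁻¹»)] -/
theorem trace_R (W : (Matrix (Fin N) (Fin N) ℂ)ˣ) (X : Matrix (Fin N) (Fin N) ℂ) : (R W X).trace = X.trace := by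
  rw [R_def, Matrix.trace_mul_comm, ← mul_assoc, Units.inv_mul, one_mul]

/-- ★ **`D^{1*}` PRESERVES REAL TRACES**: if every value of the plaquette function `F` has real trace (`(tr F)* = tr F`), so does `(D^{1*}_U F)_μ(x)` —
(3.9) is a signed sum of unitary conjugates `R(·)F` and of values of `F`. [cite: Balaban1985BackgroundPropagators, (3.8)–(3.9) p.392] -/
theorem star_trace_divP (F : ι → ι → S → Matrix (Fin N) (Fin N) ℂ) (hF : ∀ κ ν y, star (F κ ν y).trace = (F κ ν y).trace) (μ : ι) (x : S) :
    star (divP T U F μ x).trace = (divP T U F μ x).trace := by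
  have hD : ∀ (ν : ι) (G : S → Matrix (Fin N) (Fin N) ℂ), (∀ y, star (G y).trace = (G y).trace) →
      star (covDstar T U ν G x).trace = (covDstar T U ν G x).trace := by
    intro ν G hG
    rw [covDstar, Matrix.trace_sub, trace_R, star_sub, hG, hG]
  rw [divP, Matrix.trace_sub, Matrix.trace_sum, Matrix.trace_sum, star_sub, star_sum, star_sum]
  congr 1
  · refine Finset.sum_congr rfl fun ν _ => ?_
    split_ifs
    · exact hD ν _ fun y => hF ν μ y
    · rw [Matrix.trace_zero, star_zero]
  · refine Finset.sum_congr rfl fun ν _ => ?_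
    split_ifs
    · exact hD ν _ fun y => hF μ ν y
    · rw [Matrix.trace_zero, star_zero]

/-- ★ **THE CURRENT IS HERMITIAN AT A UNITARY BACKGROUND**: `J(b)* = J(b)` for lit-balaban's `B9Eq39Adjoint.J T U η` whenever `U(b)⁻¹ = U(b)*` bondwise
(`J = η⁻²·Im(D^{η*}∂U)` by `B11Eq27Current.J_eq_imPart_div`, and `Im X = (2i)⁻¹(X − X*)` is Hermitian). [cite: Balaban1985Variational, (28) p.282;
Balaban1985BackgroundPropagators, (3.11) p.392] -/
theorem star_J_eq_self (hU : ∀ μ x, (((U μ x)⁻¹ : (Matrix (Fin N) (Fin N) ℂ)ˣ) : Matrix (Fin N) (Fin N) ℂ) = star (U μ x : Matrix (Fin N) (Fin N) ℂ))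
    (η : ℝ) (μ : ι) (x : S) : star (J T U η μ x) = J T U η μ x := by
  rw [J_eq_imPart_div T U hU, star_smul, star_eta_sq]
  congr 1
  rw [imPart, star_smul, star_sub, star_star, star_inv₀, star_mul, Complex.star_def, Complex.conj_I, map_ofNat]
  have h2 : (-Complex.I * 2)⁻¹ = -(2 * Complex.I)⁻¹ := by rw [mul_comm, ← neg_mul_eq_mul_neg, neg_inv]
  rw [h2, neg_smul, ← smul_neg, neg_sub]

/-- ★ **THE CURRENT IS TRACELESS WHEN THE PLAQUETTE VARIABLES HAVE REAL TRACE**: `tr J(b) = 0` at a unitary background all of whose plaquette variables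
`U(∂p)` satisfy `(tr U(∂p))* = tr U(∂p)` (`tr Im X = (2i)⁻¹(tr X − (tr X)*)` and `tr D^{η*}∂U` is real by `star_trace_divP`).
[cite: Balaban1985Variational, (28) p.282; Balaban1985BackgroundPropagators, (3.11) p.392] -/
theorem trace_J_eq_zero (hU : ∀ μ x, (((U μ x)⁻¹ : (Matrix (Fin N) (Fin N) ℂ)ˣ) : Matrix (Fin N) (Fin N) ℂ) = star (U μ x : Matrix (Fin N) (Fin N) ℂ))
    (htr : ∀ κ ν y, star ((plaqU T U κ ν y : (Matrix (Fin N) (Fin N) ℂ)ˣ) : Matrix (Fin N) (Fin N) ℂ).trace =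
      ((plaqU T U κ ν y : (Matrix (Fin N) (Fin N) ℂ)ˣ) : Matrix (Fin N) (Fin N) ℂ).trace)
    (η : ℝ) (μ : ι) (x : S) : (J T U η μ x).trace = 0 := by
  have hY : star (divPη T U η (plaqField T U) μ x).trace = (divPη T U η (plaqField T U) μ x).trace := by
    rw [divPη, Matrix.trace_smul, smul_eq_mul, star_mul', star_eta_inv, star_trace_divP T U (plaqField T U) (fun κ ν y => htr κ ν y)]
  rw [J_eq_imPart_div T U hU, Matrix.trace_smul, imPart, Matrix.trace_smul, Matrix.trace_sub, Matrix.star_eq_conjTranspose,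
    Matrix.trace_conjTranspose, hY, sub_self, smul_zero, smul_zero]

end Lattice

/-! ## §2 `SU(2)`: real traces, and the current of an `SU(2)`-valued reading is Hermitian and traceless -/

section SU2

/-- For a unit `W` of `M₂(ℂ)` whose matrix lies in `SU(2)`: `W⁻¹ = W*` as matrices. [folklore] -/
theorem val_inv_eq_star_of_mem_su2 {W : (Matrix (Fin 2) (Fin 2) ℂ)ˣ} (hW : (W : Matrix (Fin 2) (Fin 2) ℂ) ∈ Matrix.specialUnitaryGroup (Fin 2) ℂ) :
    ((W⁻¹ : (Matrix (Fin 2) (Fin 2) ℂ)ˣ) : Matrix (Fin 2) (Fin 2) ℂ) = star (W : Matrix (Fin 2) (Fin 2) ℂ) := by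
  have h1 : star (W : Matrix (Fin 2) (Fin 2) ℂ) * W = 1 := Matrix.mem_unitaryGroup_iff'.1 (Matrix.mem_specialUnitaryGroup_iff.1 hW).1
  exact Units.inv_eq_of_mul_eq_one_left h1

/-- … and `W⁻¹` lies in `SU(2)` again. [folklore] -/
theorem val_inv_mem_su2 {W : (Matrix (Fin 2) (Fin 2) ℂ)ˣ} (hW : (W : Matrix (Fin 2) (Fin 2) ℂ) ∈ Matrix.specialUnitaryGroup (Fin 2) ℂ) :
    ((W⁻¹ : (Matrix (Fin 2) (Fin 2) ℂ)ˣ) : Matrix (Fin 2) (Fin 2) ℂ) ∈ Matrix.specialUnitaryGroup (Fin 2) ℂ := by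
  rw [val_inv_eq_star_of_mem_su2 hW]
  exact (star (⟨_, hW⟩ : Matrix.specialUnitaryGroup (Fin 2) ℂ)).2

variable {S : Type*} {ι : Type*} (T : ι → Equiv.Perm S) (U : ι → S → (Matrix (Fin 2) (Fin 2) ℂ)ˣ)

/-- **Plaquette variables of an `SU(2)`-valued reading are `SU(2)` matrices** (`U(∂p) = U_μ(x)U_ν(x+e_μ)U_μ(x+e_ν)⁻¹U_ν(x)⁻¹`).
[cite: Balaban1985BackgroundPropagators, (3.1) p.390] -/
theorem plaqU_val_mem_su2 (hU : ∀ μ x, ((U μ x : (Matrix (Fin 2) (Fin 2) ℂ)ˣ) : Matrix (Fin 2) (Fin 2) ℂ) ∈ Matrix.specialUnitaryGroup (Fin 2) ℂ)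
    (μ ν : ι) (x : S) : ((plaqU T U μ ν x : (Matrix (Fin 2) (Fin 2) ℂ)ˣ) : Matrix (Fin 2) (Fin 2) ℂ) ∈ Matrix.specialUnitaryGroup (Fin 2) ℂ := by
  rw [plaqU, Units.val_mul, Units.val_mul, Units.val_mul]
  exact Submonoid.mul_mem _ (Submonoid.mul_mem _ (Submonoid.mul_mem _ (hU μ x) (hU ν _)) (val_inv_mem_su2 (hU μ _))) (val_inv_mem_su2 (hU ν x))

/-- ★★ **THE CURRENT `J(U₀)` OF AN `SU(2)`-VALUED READING IS HERMITIAN AND TRACELESS** — for lit-balaban's letter `B11Eq98CurrentSlot.Jcur U₀ ∈ |·|₍₋₃₎`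
(any lattice `Bond d Pd`, any weights `(L, η, lev₀)`): at every bond `b`, `(Jcur U₀)(b)* = (Jcur U₀)(b)` and `tr (Jcur U₀)(b) = 0`.  This is the
`J(U₀) ∈ T` hypothesis of the knit's reality tool for `T :=` {Hermitian traceless (−3)-data}. [cite: Balaban1985Variational, (28) p.282, (51) p.286, Prop. 6 p.295] -/
theorem isHermitian_trace_zero_Jcur {d : ℕ} {Pd : Fin d → ℕ} {L η : ℝ} [Fact (0 < L)] [Fact (0 < η)] {lev₀ : Bond d Pd → ℕ}
    (U₀ : Bond d Pd → (Matrix (Fin 2) (Fin 2) ℂ)ˣ)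
    (hU : ∀ b, ((U₀ b : (Matrix (Fin 2) (Fin 2) ℂ)ˣ) : Matrix (Fin 2) (Fin 2) ℂ) ∈ Matrix.specialUnitaryGroup (Fin 2) ℂ) (b : Bond d Pd) :
    (NegSup.equiv (levWeight L η lev₀ 3) (Matrix (Fin 2) (Fin 2) ℂ) (Jcur (L := L) (η := η) (lev₀ := lev₀) U₀) b).IsHermitian ∧
      (NegSup.equiv (levWeight L η lev₀ 3) (Matrix (Fin 2) (Fin 2) ℂ) (Jcur (L := L) (η := η) (lev₀ := lev₀) U₀) b).trace = 0 := by
  have hJ : NegSup.equiv (levWeight L η lev₀ 3) (Matrix (Fin 2) (Fin 2) ℂ) (Jcur (L := L) (η := η) (lev₀ := lev₀) U₀) b =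
      J Tsh (Ucur U₀) η b.2 b.1 := rfl
  have hUc : ∀ (μ : Fin d) (x : TSite d Pd), ((Ucur U₀ μ x : (Matrix (Fin 2) (Fin 2) ℂ)ˣ) : Matrix (Fin 2) (Fin 2) ℂ) ∈
      Matrix.specialUnitaryGroup (Fin 2) ℂ := fun μ x => hU (x, μ)
  have hUs : ∀ (μ : Fin d) (x : TSite d Pd), (((Ucur U₀ μ x)⁻¹ : (Matrix (Fin 2) (Fin 2) ℂ)ˣ) : Matrix (Fin 2) (Fin 2) ℂ) =
      star (Ucur U₀ μ x : Matrix (Fin 2) (Fin 2) ℂ) := fun μ x => val_inv_eq_star_of_mem_su2 (hUc μ x)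
  rw [hJ]
  refine ⟨?_, trace_J_eq_zero Tsh (Ucur U₀) hUs (fun κ ν y => star_trace_of_mem_specialUnitaryGroup (plaqU_val_mem_su2 Tsh (Ucur U₀) hUc κ ν y)) η b.2 b.1⟩
  rw [Matrix.IsHermitian, ← Matrix.star_eq_conjTranspose]
  exact star_J_eq_self Tsh (Ucur U₀) hUs η b.2 b.1

end SU2

/-! ## §3 The T³ readings: the chart-generic background of `Prop7SectET3ObjectsPd` and the background of record `bgOfCfg F K U₀` -/

section T3

variable {F : T3Family} {n K : ℕ}

/-- ★★ **AT THE T³ OBJECTS (chart-generic reading)**: for every chart `e` of the run-`K` sites onto lit-balaban's torus `TSite 3 Pd` and every `SU(2)`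
configuration `U₀`, the current of the reading `b ↦ U₀⟨e⁻¹ b.1, b.2⟩` (the background letter of ✓`Prop7SectET3ObjectsPd.prop6_T3` ∕ the knit's
`solution_mem_of_invariant_T3`) is Hermitian and traceless at every bond — NO shift-compatibility of `e` is needed. [cite: Balaban1985Variational, (28) p.282, (51) p.286] -/
theorem isHermitian_trace_zero_Jcur_T3 {Pd : Fin (F.P K).d → ℕ} (e : Site (F.P K) 0 ≃ TSite (F.P K).d Pd)
    [Fact (0 < (F.L : ℝ))] [Fact (0 < ((F.L : ℝ)⁻¹) ^ (K - n))]
    (U₀ : GaugeField (F.P K) 0 (Matrix.specialUnitaryGroup (Fin 2) ℂ)) (b : Bond (F.P K).d Pd) :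
    (NegSup.equiv (levWeight (F.L : ℝ) (((F.L : ℝ)⁻¹) ^ (K - n)) (fun _ : Bond (F.P K).d Pd => K - n) 3) (Matrix (Fin 2) (Fin 2) ℂ)
        (Jcur (L := (F.L : ℝ)) (η := ((F.L : ℝ)⁻¹) ^ (K - n)) (lev₀ := fun _ : Bond (F.P K).d Pd => K - n)
          (fun b : Bond (F.P K).d Pd => unitsField (toUField U₀) ⟨e.symm b.1, b.2⟩)) b).IsHermitian ∧
    (NegSup.equiv (levWeight (F.L : ℝ) (((F.L : ℝ)⁻¹) ^ (K - n)) (fun _ : Bond (F.P K).d Pd => K - n) 3) (Matrix (Fin 2) (Fin 2) ℂ)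
        (Jcur (L := (F.L : ℝ)) (η := ((F.L : ℝ)⁻¹) ^ (K - n)) (lev₀ := fun _ : Bond (F.P K).d Pd => K - n)
          (fun b : Bond (F.P K).d Pd => unitsField (toUField U₀) ⟨e.symm b.1, b.2⟩)) b).trace = 0 :=
  isHermitian_trace_zero_Jcur _ (fun b' => by
    rw [val_unitsField]
    exact (U₀ ⟨e.symm b'.1, b'.2⟩).2) b

/-- ★★ **AT THE BACKGROUND OF RECORD `bgOfCfg F K U₀`** (✓`Prop7SectET3Transport.bgOfCfg`, the letter of the knit's `Jcur (bgOfCfg … U₀)` in `hXtw″` ∕ `hA₁R`):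
the current is Hermitian and traceless at every bond of `Bond 3 (periodsT3 F K)`. [cite: Balaban1985Variational, (28) p.282, (51) p.286, Prop. 6 p.295] -/
theorem isHermitian_trace_zero_Jcur_bgOfCfg [Fact (0 < (F.L : ℝ))] [Fact (0 < ((F.L : ℝ)⁻¹) ^ (K - n))]
    (U₀ : GaugeField (F.P K) 0 (Matrix.specialUnitaryGroup (Fin 2) ℂ)) (b : Bond 3 (periodsT3 F K)) :
    (NegSup.equiv (levWeight (F.L : ℝ) (((F.L : ℝ)⁻¹) ^ (K - n)) (fun _ : Bond 3 (periodsT3 F K) => K - n) 3) (Matrix (Fin 2) (Fin 2) ℂ)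
        (Jcur (L := (F.L : ℝ)) (η := ((F.L : ℝ)⁻¹) ^ (K - n)) (lev₀ := fun _ : Bond 3 (periodsT3 F K) => K - n) (bgOfCfg F K U₀)) b).IsHermitian ∧
    (NegSup.equiv (levWeight (F.L : ℝ) (((F.L : ℝ)⁻¹) ^ (K - n)) (fun _ : Bond 3 (periodsT3 F K) => K - n) 3) (Matrix (Fin 2) (Fin 2) ℂ)
        (Jcur (L := (F.L : ℝ)) (η := ((F.L : ℝ)⁻¹) ^ (K - n)) (lev₀ := fun _ : Bond 3 (periodsT3 F K) => K - n) (bgOfCfg F K U₀)) b).trace = 0 := by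
  rw [bgOfCfg_eq]
  exact isHermitian_trace_zero_Jcur_T3 (n := n) (siteEquiv F K) U₀ b

/-- **THE SET FORM the knit's tool consumes**: `Jcur (bgOfCfg F K U₀) ∈ {f | ∀ b, (f b) Hermitian ∧ tr (f b) = 0}` — the `hJT` hypothesis of
`Prop7Prop6RealSolution.solution_mem_of_invariant_T3` at `T :=` the Hermitian traceless (−3)-data. [cite: Balaban1985Variational, Prop. 6 p.295, (51) p.286] -/
theorem Jcur_bgOfCfg_mem_hermitianTraceless [Fact (0 < (F.L : ℝ))] [Fact (0 < ((F.L : ℝ)⁻¹) ^ (K - n))]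
    (U₀ : GaugeField (F.P K) 0 (Matrix.specialUnitaryGroup (Fin 2) ℂ)) :
    Jcur (L := (F.L : ℝ)) (η := ((F.L : ℝ)⁻¹) ^ (K - n)) (lev₀ := fun _ : Bond 3 (periodsT3 F K) => K - n) (bgOfCfg F K U₀) ∈
      {f : NegSize (F.L : ℝ) (((F.L : ℝ)⁻¹) ^ (K - n)) (fun _ : Bond 3 (periodsT3 F K) => K - n) 3 (Matrix (Fin 2) (Fin 2) ℂ) |
        ∀ b, (NegSup.equiv (levWeight (F.L : ℝ) (((F.L : ℝ)⁻¹) ^ (K - n)) (fun _ : Bond 3 (periodsT3 F K) => K - n) 3) (Matrix (Fin 2) (Fin 2) ℂ) f b).IsHermitian ∧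
          (NegSup.equiv (levWeight (F.L : ℝ) (((F.L : ℝ)⁻¹) ^ (K - n)) (fun _ : Bond 3 (periodsT3 F K) => K - n) 3) (Matrix (Fin 2) (Fin 2) ℂ) f b).trace = 0} :=
  fun b => isHermitian_trace_zero_Jcur_bgOfCfg (n := n) U₀ b

end T3

end Summit.QuantumFields.YangMills.Theorems.Prop7SectET3JcurReality

end
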